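import Summits.Ventures.HodgeRepro2.T5BergmanSchurPolarized
import Summits.Ventures.HodgeRepro2.T5BergmanSchurGeneralU11
import Summits.Ventures.HodgeRepro2.T5BergmanSchurPolarizedU11
import Summits.Ventures.HodgeRepro2.T5BergmanOrbitTotal
import Summits.Ventures.HodgeRepro2.T5BergmanSchurHaar
import Summits.Ventures.HodgeRepro2.T5BergmanSchurRuhl
import Summits.Ventures.HodgeRepro2.T5BergmanStrongContinuity
import Summits.Ventures.HodgeRepro2.T5BergmanModelEquiv
import Summits.Ventures.HodgeRepro2.T5BergmanKTypeProjector

/-!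
# One entry point: Schur orthogonality with both vectors arbitrary for the explicit weight-`k` model

The explicit weighted Bergman model `A_k` (`k ≥ 2`) of the holomorphic discrete series of `SU(1,1)`
on the disc (`T5BergmanCoefficient.act` / `pairing`) is, at this point of the tree, known to satisfy —
for ALL holomorphic vectors, not only the lowest-weight vector:

* **Schur orthogonality** against Rühl's Haar measure `μ_R = ν/π` (`schur`), its polarised form, THE
  ORTHOGONALITY RELATIONS (`schur_relations`), the `π₃⁺` case with formal degree `2`
  (`schur_relations_three`), the relation against EVERY Haar measure of `SU(1,1)` (`schur_haar`) and in
  Rühl's normalisation `(Φ, T_g Ψ)` (`schur_ruhl`);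
* the same on `H_j = U(1,1)` against every Haar measure (`schur_U11`, `schur_U11_pos`,
  `schur_relations_U11`);
* the **`K`-type projector** `∫_K u^{k+2m} π_k(rot u) f du = a_m zᵐ` (`ktype_projector`), **orbit
  totality** (`orbit_total`), **strong continuity** of `g ↦ π_k(g) f` in `A_k`
  (`strongly_continuous`), the **Casimir eigenvalue** `k(k-2)/2` on every holomorphic vector
  (`casimir_all`), and the identification of the `K`-finite vectors with the abstract lowest-weight
  `𝔰𝔩₂`-module (`kfinite_is_model`).

Every theorem below is a restatement by name of a theorem of the files imported above; this file adds
no mathematics. Blind lane: Mathlib + the HodgeRepro2 prefix only; no sorry; axioms ⊆ {propext,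
Classical.choice, Quot.sound}.
-/

namespace Summit.Ventures.HodgeRepro2.T5BergmanSchurSummary

open MeasureTheory MeasureTheory.Measure Metric Filter Topology
open T5PoincareMeasure T5SU11Unimodular T5U11Unimodular T5U11Product T5SU11Fibration
  T5SU11FibrationHaar T5HaarCircle T5SU11CoefficientL2
open T5BergmanCoefficient T5BergmanPairing T5BergmanUnitary T5BergmanParseval T5BergmanRuhlModel
  T5BergmanMatrixCoeff T5BergmanLieModule T5BergmanModelEquiv
open scoped Real

variable [MeasurableSpace Circle] [BorelSpace Circle]

/-- **Schur orthogonality, both vectors arbitrary**: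
`∫_G |⟨π_k(g) f, h⟩_k|² dμ_R = ⟨f,f⟩_k ⟨h,h⟩_k / (k-1)` for all holomorphic `f, h ∈ A_k`, `k ≥ 2`
(`T5BergmanSchurGeneral.schur`). -/
theorem schur (k : ℕ) (hk : 2 ≤ k) (f h : ℂ → ℂ) (hf : DifferentiableOn ℂ f (ball 0 1))
    (hfint : IntegrableOn (fun w => ‖f w‖ ^ 2 * (1 - ‖w‖ ^ 2) ^ (k - 2)) (ball (0 : ℂ) 1))
    (hh : DifferentiableOn ℂ h (ball 0 1))
    (hhint : IntegrableOn (fun w => ‖h w‖ ^ 2 * (1 - ‖w‖ ^ 2) ^ (k - 2)) (ball (0 : ℂ) 1)) :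
    ∫ g, ‖pairing k (act k g f) h‖ ^ 2 ∂ruhl =
      (pairing k f f).re * (pairing k h h).re / ((k : ℝ) - 1) :=
  T5BergmanSchurGeneral.schur k hk f h hf hfint hh hhint

/-- **The Schur orthogonality relations**:
`∫_G ⟨π_k(g) f₁, h₁⟩_k conj ⟨π_k(g) f₂, h₂⟩_k dμ_R = ⟨f₁, f₂⟩_k ⟨h₂, h₁⟩_k / (k - 1)`
(`T5BergmanSchurPolarized.schur_relations'`). -/
theorem schur_relations (k : ℕ) (hk : 2 ≤ k) (f₁ f₂ h₁ h₂ : ℂ → ℂ)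
    (hf₁ : DifferentiableOn ℂ f₁ (ball 0 1))
    (hf₁int : IntegrableOn (fun w => ‖f₁ w‖ ^ 2 * (1 - ‖w‖ ^ 2) ^ (k - 2)) (ball (0 : ℂ) 1))
    (hf₂ : DifferentiableOn ℂ f₂ (ball 0 1))
    (hf₂int : IntegrableOn (fun w => ‖f₂ w‖ ^ 2 * (1 - ‖w‖ ^ 2) ^ (k - 2)) (ball (0 : ℂ) 1))
    (hh₁ : DifferentiableOn ℂ h₁ (ball 0 1))
    (hh₁int : IntegrableOn (fun w => ‖h₁ w‖ ^ 2 * (1 - ‖w‖ ^ 2) ^ (k - 2)) (ball (0 : ℂ) 1))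
    (hh₂ : DifferentiableOn ℂ h₂ (ball 0 1))
    (hh₂int : IntegrableOn (fun w => ‖h₂ w‖ ^ 2 * (1 - ‖w‖ ^ 2) ^ (k - 2)) (ball (0 : ℂ) 1)) :
    ∫ g, pairing k (act k g f₁) h₁ * (starRingEnd ℂ) (pairing k (act k g f₂) h₂) ∂ruhl =
      pairing k f₁ f₂ * pairing k h₂ h₁ / ((k : ℂ) - 1) :=
  T5BergmanSchurPolarized.schur_relations' k hk f₁ f₂ h₁ h₂ hf₁ hf₁int hf₂ hf₂int hh₁ hh₁int hh₂
    hh₂int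

/-- The relations for `π₃⁺` (formal degree `2`) (`T5BergmanSchurPolarized.schur_relations_three`). -/
theorem schur_relations_three (f₁ f₂ h₁ h₂ : ℂ → ℂ) (hf₁ : DifferentiableOn ℂ f₁ (ball 0 1))
    (hf₁int : IntegrableOn (fun w => ‖f₁ w‖ ^ 2 * (1 - ‖w‖ ^ 2) ^ (3 - 2)) (ball (0 : ℂ) 1))
    (hf₂ : DifferentiableOn ℂ f₂ (ball 0 1))
    (hf₂int : IntegrableOn (fun w => ‖f₂ w‖ ^ 2 * (1 - ‖w‖ ^ 2) ^ (3 - 2)) (ball (0 : ℂ) 1))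
    (hh₁ : DifferentiableOn ℂ h₁ (ball 0 1))
    (hh₁int : IntegrableOn (fun w => ‖h₁ w‖ ^ 2 * (1 - ‖w‖ ^ 2) ^ (3 - 2)) (ball (0 : ℂ) 1))
    (hh₂ : DifferentiableOn ℂ h₂ (ball 0 1))
    (hh₂int : IntegrableOn (fun w => ‖h₂ w‖ ^ 2 * (1 - ‖w‖ ^ 2) ^ (3 - 2)) (ball (0 : ℂ) 1)) :
    ∫ g, pairing 3 (act 3 g f₁) h₁ * (starRingEnd ℂ) (pairing 3 (act 3 g f₂) h₂) ∂ruhl =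
      pairing 3 f₁ f₂ * pairing 3 h₂ h₁ / 2 :=
  T5BergmanSchurPolarized.schur_relations_three f₁ f₂ h₁ h₂ hf₁ hf₁int hf₂ hf₂int hh₁ hh₁int hh₂
    hh₂int

/-- **Against every Haar measure `μ` of `SU(1,1)`**: `c_μ • ∫_G |⟨π_k(g) f, h⟩_k|² dμ = π ⟨f,f⟩_k ⟨h,h⟩_k/(k-1)`,
`c_μ = haarScalarFactor ν μ` (`T5BergmanSchurHaar.schur_haar`). -/
theorem schur_haar (μ : Measure SU11) [IsHaarMeasure μ] (k : ℕ) (hk : 2 ≤ k) (f h : ℂ → ℂ)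
    (hf : DifferentiableOn ℂ f (ball 0 1))
    (hfint : IntegrableOn (fun w => ‖f w‖ ^ 2 * (1 - ‖w‖ ^ 2) ^ (k - 2)) (ball (0 : ℂ) 1))
    (hh : DifferentiableOn ℂ h (ball 0 1))
    (hhint : IntegrableOn (fun w => ‖h w‖ ^ 2 * (1 - ‖w‖ ^ 2) ^ (k - 2)) (ball (0 : ℂ) 1)) :
    (haarScalarFactor (nu haarCircle) μ : ℝ) • ∫ g, ‖pairing k (act k g f) h‖ ^ 2 ∂μ =
      π * ((pairing k f f).re * (pairing k h h).re / ((k : ℝ) - 1)) :=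
  T5BergmanSchurHaar.schur_haar μ k hk f h hf hfint hh hhint

/-- **In Rühl's normalisation**: `∫_G |(Φ, T_g Ψ)|² dμ_R = (Φ,Φ)(Ψ,Ψ)/(2k_R - 1)` for all `Φ, Ψ ∈ A_k`
(`T5BergmanSchurRuhl.integral_norm_ruhlInner_act_sq`). -/
theorem schur_ruhl (k : ℕ) (hk : 2 ≤ k) (Φ Ψ : ℂ → ℂ) (hΦ : DifferentiableOn ℂ Φ (ball 0 1))
    (hΦint : IntegrableOn (fun w => ‖Φ w‖ ^ 2 * (1 - ‖w‖ ^ 2) ^ (k - 2)) (ball (0 : ℂ) 1))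
    (hΨ : DifferentiableOn ℂ Ψ (ball 0 1))
    (hΨint : IntegrableOn (fun w => ‖Ψ w‖ ^ 2 * (1 - ‖w‖ ^ 2) ^ (k - 2)) (ball (0 : ℂ) 1)) :
    ∫ g, ‖ruhlInner k Φ (act k g Ψ)‖ ^ 2 ∂ruhl =
      (ruhlInner k Φ Φ).re * (ruhlInner k Ψ Ψ).re / ((k : ℝ) - 1) :=
  T5BergmanSchurRuhl.integral_norm_ruhlInner_act_sq k hk Φ Ψ hΦ hΦint hΨ hΨint

/-- **Orbit totality** (`T5BergmanOrbitTotal.orbit_total`): a vector orthogonal to the whole orbit of a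
non-zero vector vanishes. -/
theorem orbit_total (k : ℕ) (hk : 2 ≤ k) (f h : ℂ → ℂ) (hf : DifferentiableOn ℂ f (ball 0 1))
    (hfint : IntegrableOn (fun w => ‖f w‖ ^ 2 * (1 - ‖w‖ ^ 2) ^ (k - 2)) (ball (0 : ℂ) 1))
    (hh : DifferentiableOn ℂ h (ball 0 1))
    (hhint : IntegrableOn (fun w => ‖h w‖ ^ 2 * (1 - ‖w‖ ^ 2) ^ (k - 2)) (ball (0 : ℂ) 1))
    (hne : ∃ z ∈ ball (0 : ℂ) 1, h z ≠ 0) (h0 : ∀ g : SU11, pairing k (act k g f) h = 0) :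
    ∀ z ∈ ball (0 : ℂ) 1, f z = 0 :=
  T5BergmanOrbitTotal.orbit_total k hk f h hf hfint hh hhint hne h0

variable [MeasurableSpace U11] [BorelSpace U11]

/-- **On `H_j = U(1,1)`, every pair**: `c_U • ∫_{U(1,1)} |⟨π_k(g) f, h⟩_k|² dμ_U = π ⟨f,f⟩_k ⟨h,h⟩_k/(k-1)`
(`T5BergmanSchurGeneralU11.integral_norm_matrixCoeffU_sq`). -/
theorem schur_U11 (μU : Measure U11) [IsHaarMeasure μU] (k : ℕ) (hk : 2 ≤ k) (f h : ℂ → ℂ)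
    (hf : DifferentiableOn ℂ f (ball 0 1))
    (hfint : IntegrableOn (fun w => ‖f w‖ ^ 2 * (1 - ‖w‖ ^ 2) ^ (k - 2)) (ball (0 : ℂ) 1))
    (hh : DifferentiableOn ℂ h (ball 0 1))
    (hhint : IntegrableOn (fun w => ‖h w‖ ^ 2 * (1 - ‖w‖ ^ 2) ^ (k - 2)) (ball (0 : ℂ) 1)) :
    (haarScalarFactor (map mulHom (haarCircle.prod (nu haarCircle))) μU : ℝ) •
      ∫ g, ‖T5BergmanSchurGeneralU11.matrixCoeffU k f h g‖ ^ 2 ∂μU =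
        π * ((pairing k f f).re * (pairing k h h).re / ((k : ℝ) - 1)) :=
  T5BergmanSchurGeneralU11.integral_norm_matrixCoeffU_sq μU k hk f h hf hfint hh hhint

/-- **Positivity on `H_j`** for `f, h ≠ 0` (`T5BergmanSchurGeneralU11.integral_norm_matrixCoeffU_sq_pos`). -/
theorem schur_U11_pos (μU : Measure U11) [IsHaarMeasure μU] (k : ℕ) (hk : 2 ≤ k) (f h : ℂ → ℂ)
    (hf : DifferentiableOn ℂ f (ball 0 1))
    (hfint : IntegrableOn (fun w => ‖f w‖ ^ 2 * (1 - ‖w‖ ^ 2) ^ (k - 2)) (ball (0 : ℂ) 1))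
    (hh : DifferentiableOn ℂ h (ball 0 1))
    (hhint : IntegrableOn (fun w => ‖h w‖ ^ 2 * (1 - ‖w‖ ^ 2) ^ (k - 2)) (ball (0 : ℂ) 1))
    (hf0 : 0 < (pairing k f f).re) (hh0 : 0 < (pairing k h h).re) :
    0 < ∫ g, ‖T5BergmanSchurGeneralU11.matrixCoeffU k f h g‖ ^ 2 ∂μU :=
  T5BergmanSchurGeneralU11.integral_norm_matrixCoeffU_sq_pos μU k hk f h hf hfint hh hhint hf0 hh0

/-- **The orthogonality relations on `H_j = U(1,1)`**
(`T5BergmanSchurPolarizedU11.integral_matrixCoeffU_mul_conj`). -/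
theorem schur_relations_U11 (μU : Measure U11) [IsHaarMeasure μU] (k : ℕ) (hk : 2 ≤ k)
    (f₁ h₁ f₂ h₂ : ℂ → ℂ) (hf₁ : DifferentiableOn ℂ f₁ (ball 0 1))
    (hf₁int : IntegrableOn (fun w => ‖f₁ w‖ ^ 2 * (1 - ‖w‖ ^ 2) ^ (k - 2)) (ball (0 : ℂ) 1))
    (hh₁ : DifferentiableOn ℂ h₁ (ball 0 1))
    (hh₁int : IntegrableOn (fun w => ‖h₁ w‖ ^ 2 * (1 - ‖w‖ ^ 2) ^ (k - 2)) (ball (0 : ℂ) 1))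
    (hf₂ : DifferentiableOn ℂ f₂ (ball 0 1))
    (hf₂int : IntegrableOn (fun w => ‖f₂ w‖ ^ 2 * (1 - ‖w‖ ^ 2) ^ (k - 2)) (ball (0 : ℂ) 1))
    (hh₂ : DifferentiableOn ℂ h₂ (ball 0 1))
    (hh₂int : IntegrableOn (fun w => ‖h₂ w‖ ^ 2 * (1 - ‖w‖ ^ 2) ^ (k - 2)) (ball (0 : ℂ) 1)) :
    (haarScalarFactor (map mulHom (haarCircle.prod (nu haarCircle))) μU : ℝ) •
      ∫ g, T5BergmanSchurGeneralU11.matrixCoeffU k f₁ h₁ g *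
        (starRingEnd ℂ) (T5BergmanSchurGeneralU11.matrixCoeffU k f₂ h₂ g) ∂μU =
        (π : ℂ) * (pairing k f₁ f₂ * pairing k h₂ h₁ / ((k : ℂ) - 1)) :=
  T5BergmanSchurPolarizedU11.integral_matrixCoeffU_mul_conj μU k hk f₁ h₁ f₂ h₂ hf₁ hf₁int hh₁ hh₁int
    hf₂ hf₂int hh₂ hh₂int

omit [MeasurableSpace U11] [BorelSpace U11] in
/-- **The `K`-type projector**: `∫_K u^{k+2m} (π_k(rot u) f)(w) du = a_m wᵐ` for holomorphic `f` with
Taylor coefficients `a` (`T5BergmanKTypeProjector.integral_circle_pow_mul_act_rot_taylor`). -/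
theorem ktype_projector (k m : ℕ) (f : ℂ → ℂ) (hf : DifferentiableOn ℂ f (ball 0 1)) {w : ℂ}
    (hw : w ∈ ball (0 : ℂ) 1) :
    ∫ u : Circle, (u : ℂ) ^ (k + 2 * m) * act k (rot u) f w ∂haarCircle = taylorCoeff f m * w ^ m :=
  T5BergmanKTypeProjector.integral_circle_pow_mul_act_rot_taylor k m f hf hw

omit [MeasurableSpace Circle] [BorelSpace Circle] [MeasurableSpace U11] [BorelSpace U11] in
/-- **Strong continuity**: `‖π_k(g) f - π_k(g₀) f‖_k² → 0` as `g → g₀`, for every holomorphic `f ∈ A_k`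
(`T5BergmanStrongContinuity.tendsto_pairing_act_sub`). -/
theorem strongly_continuous (k : ℕ) (hk : 2 ≤ k) (f : ℂ → ℂ) (hf : DifferentiableOn ℂ f (ball 0 1))
    (hfint : IntegrableOn (fun w => ‖f w‖ ^ 2 * (1 - ‖w‖ ^ 2) ^ (k - 2)) (ball (0 : ℂ) 1))
    (g₀ : SU11) :
    Tendsto (fun g => (pairing k (act k g f - act k g₀ f) (act k g f - act k g₀ f)).re) (𝓝 g₀)
      (𝓝 0) :=
  T5BergmanStrongContinuity.tendsto_pairing_act_sub k hk f hf hfint g₀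

omit [MeasurableSpace Circle] [BorelSpace Circle] [MeasurableSpace U11] [BorelSpace U11] in
/-- **The Casimir eigenvalue on every holomorphic vector**:
`½ H² f + E F f + F E f = ½ k (k-2) f` on the disc (`T5BergmanLieModule.casimir`). -/
theorem casimir_all (k : ℕ) {f : ℂ → ℂ} (hf : DifferentiableOn ℂ f (ball 0 1)) {w : ℂ}
    (hw : w ∈ ball (0 : ℂ) 1) :
    (1 / 2 : ℂ) * weightOp k (weightOp k f) w + raiseOp k (lowerOp f) w + lowerOp (raiseOp k f) w =
      (1 / 2 : ℂ) * (k : ℂ) * ((k : ℂ) - 2) * f w :=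
  T5BergmanLieModule.casimir k hf hw

omit [MeasurableSpace Circle] [BorelSpace Circle] [MeasurableSpace U11] [BorelSpace U11] in
/-- **The `K`-finite vectors are the abstract lowest-weight module**: through `D`, the operators
`E = raiseOp`, `F = lowerOp`, `H = weightOp` on polynomials are the standard `e₀, f₀, h₀` on the
lowest-weight `𝔰𝔩₂`-module of weight `k` (`T5BergmanModelEquiv.lie_e₀_toModel` / `lie_f₀_toModel` /
`lie_h₀_toModel`). -/
theorem kfinite_is_model (k : ℕ) (hk : 1 ≤ k) (a : ℕ →₀ ℂ) :
    ⁅T5Sl2Standard.e₀ ℂ, toModel k (D k a)⁆ = toModel k (D k (Ep k a)) ∧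
      ⁅T5Sl2Standard.f₀ ℂ, toModel k (D k a)⁆ = toModel k (D k (Fp a)) ∧
      ⁅T5Sl2Standard.h₀ ℂ, toModel k (D k a)⁆ = toModel k (D k (Hp k a)) :=
  ⟨lie_e₀_toModel k hk a, lie_f₀_toModel k hk a, lie_h₀_toModel k a⟩

end Summit.Ventures.HodgeRepro2.T5BergmanSchurSummary
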